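import Summits.BirchSwinnertonDyer.BirchSwinnertonDyer.Theses.SignedLowerHalves

/-!
# Line sketch `horocycle_mu_floor` (UNREGISTERED, W-79; hypotheses-as-binders, 0 sorries) — crux idea `horocycle-mu-floor` for `KobayashiLowerHalfLargeImage` (item 19001)

CLASS route (D-0152): nothing here proves BSD; these are the typed statements of the idea card.

The lever: the *p-horocycle recurrence group*
`H_P(N,p) = ⟨δ ∈ Γ₀(N) : δ·ℙ¹(ℤ[1/p]) ∩ ℙ¹(ℤ[1/p]) ≠ ∅⟩ = ⟨±T^k, δ with d_δ ≡ ±p^k (mod c'_δ)⟩`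
(`c'` = prime-to-`p` part of the lower-left entry) and the conjecture / level-wise lemma
`HorocycleGeneration N p : H_P = Γ_H := {γ ∈ Γ₀(N) : d_γ mod N ∈ ⟨±1, p⟩}`.
Inflation–restriction then forces a mod-`p` modular symbol vanishing on all `{∞ → a/p^n}` to be
Eisenstein, so (`a_p = 0`, three-term descent, Kurihara/Perrin-Riou/Pollack–Weston Thm 4.1,
Pollack 2003 Prop 6.18) `min(μ(L_p^+), μ(L_p^-)) = 0`: the μ-half of the crux's `∃ ε`.
-/

open scoped MatrixGroups ModularForm

open CongruenceSubgroup WeierstrassCurve Polynomial Literature.NumberTheory.EllipticCurves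
  Literature.NumberTheory.EllipticCurves.ModularForms
  Literature.NumberTheory.EllipticCurves.Rank1Residual
  Literature.NumberTheory.EllipticCurves.Kobayashi2003 ZpExtension
  Summit.BirchSwinnertonDyer.Rank1Residual.Supersingular

namespace Summit.BirchSwinnertonDyer.BirchSwinnertonDyer.Cruxes.KobayashiLowerHalfLargeImage.HorocycleMuFloor

/-! ### The group-theoretic lever -/

/-- Prime-to-`p` part of a natural number (`c' = c / p^{v_p(c)}`; `0 ↦ 0`). -/
def primeToPart (p c : ℕ) : ℕ := c / p ^ (c.factorization p)

/-- The generating set `S(N,p)` of the `p`-horocycle recurrence group: `γ ∈ SL₂(ℤ)` with `N ∣ c_γ`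
and `d_γ ≡ ± p^k (mod c'_γ)` for some `k` (for `c_γ = 0` this reads `d_γ = ±1`, i.e. `γ = ±T^j`).
These are exactly the `δ ∈ Γ₀(N)` with `δ·ℙ¹(ℤ[1/p]) ∩ ℙ¹(ℤ[1/p]) ≠ ∅`. -/
def pHoroSet (N p : ℕ) : Set SL(2, ℤ) :=
  {γ | (N : ℤ) ∣ γ.1 1 0 ∧ ∃ (k : ℕ) (s : ℤˣ),
      ((γ.1 1 1 : ℤ) : ZMod (primeToPart p (γ.1 1 0).natAbs)) =
        ((s : ℤ) : ZMod (primeToPart p (γ.1 1 0).natAbs)) *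
          ((p : ZMod (primeToPart p (γ.1 1 0).natAbs))) ^ k}

/-- `Γ_H(N,p) = {γ ∈ Γ₀(N) : d_γ mod N ∈ ⟨±1, p⟩}` as a set (a congruence subgroup of index
`[(ℤ/N)ˣ : ⟨±1,p⟩]` in `Γ₀(N)`). -/
def GammaHSet (N p : ℕ) : Set SL(2, ℤ) :=
  {γ | (N : ℤ) ∣ γ.1 1 0 ∧ ∃ (k : ℕ) (s : ℤˣ),
      ((γ.1 1 1 : ℤ) : ZMod N) = ((s : ℤ) : ZMod N) * ((p : ZMod N)) ^ k}

/-- **(Conn) / HorocycleGeneration**: the `p`-horocycle recurrence group is all of `Γ_H(N,p)`.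
Verified by Felsch coset enumeration for `(N,p) ∈ {(24,5),(24,7),(40,3),(56,3),(92,5)}` and the
`[(ℤ/N)ˣ:⟨±p⟩] = 1` levels `11,14,20,36,50,100`; conjectured for all `p ∤ N`. -/
def HorocycleGeneration (N p : ℕ) : Prop :=
  ((Subgroup.closure (pHoroSet N p) : Subgroup SL(2, ℤ)) : Set SL(2, ℤ)) = GammaHSet N p

/-! ### The analytic target: the μ-half of the crux -/

/-- `μ(L) = 0` for `L ∈ Λ = ℤ_p⟦T⟧`: some coefficient is a `p`-adic unit. -/
def MuZero {p : ℕ} [Fact p.Prime] (L : IwasawaAlgebra p) : Prop :=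
  ∃ n : ℕ, IsUnit (PowerSeries.coeff n L)

/-- Some ω⁰-projected Mazur–Tate element `θ_n(f)` (the tree's `mazurTateElement f p n ∈ ℚ[T]`,
`Ω⁺_f`-normalised) has a coefficient of non-positive `p`-adic valuation: "`φ̄⁺_f` does not vanish on
the Δ-averaged `p`-power cusps". -/
def HoroNonvanishing {N : ℕ} [NeZero N] (f : CuspForm (Gamma0 N) 2) (p : ℕ) [Fact p.Prime] : Prop :=
  ∃ n k : ℕ, (mazurTateElement f p n).coeff k ≠ 0 ∧
    padicValRat p ((mazurTateElement f p n).coeff k) ≤ 0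

/-- **λ-part with `p` inverted** (the complement any finite-slope / affinoid engine delivers):
`ϖ L^ε ∣ p^m g` for a generator `g` of `char X^ε`. -/
def LambdaLowerDivisibility (W : WeierstrassCurve ℚ) [W.IsElliptic] [W.IsGloballyMinimal]
    (p : ℕ) [Fact p.Prime] (ε : ℤˣ) : Prop :=
  ∀ (κ : ZpExtension ℚ p) (γ : Field.absoluteGaloisGroup ℚ),
      κ.IsCyclotomic → κ.IsTopGenerator γ → IsCyclotomicVariable p γ →
    ∀ [NeZero (W.conductorNorm ℤ)] (f : CuspForm (Gamma0 (W.conductorNorm ℤ)) 2),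
      IsNewformOf W f → ∀ (ϖ : ℚ), (ϖ : ℝ) * W.realPeriodRat = plusPeriod f →
    ∀ (Lplus Lminus : IwasawaAlgebra p), IsPollackPair f p Lplus Lminus →
    ∀ (D : SignedSelmerDualData W κ γ ε),
      ∃ (g h : IwasawaAlgebra p) (m : ℕ), D.charIdeal = Ideal.span {g} ∧
        iwasawaToPowerSeries p (PowerSeries.C ((p : ℤ_[p]) ^ m) * g) =
          PowerSeries.C (ϖ : ℚ_[p]) * iwasawaToPowerSeries p (kobayashiL ε Lplus Lminus * h)

/-! ### W-level statements and the kernel-checked composition concluding the crux BY NAME -/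

/-- **Signed μ-floor, sign chosen per `(W,p)`**: one sign `ε` works for every newform `f` of `W`
and every Pollack pair (both are unique; stated this way so that `ε` is chosen before `f`). -/
def SignedMuFloorW (W : WeierstrassCurve ℚ) [W.IsElliptic] [W.IsGloballyMinimal]
    (p : ℕ) [Fact p.Prime] : Prop :=
  ∃ ε : ℤˣ, ∀ [NeZero (W.conductorNorm ℤ)] (f : CuspForm (Gamma0 (W.conductorNorm ℤ)) 2),
    IsNewformOf W f → ∀ Lplus Lminus : IwasawaAlgebra p, IsPollackPair f p Lplus Lminus →
      MuZero (kobayashiL ε Lplus Lminus)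

/-- **Period unit** (support, in print for `p` odd, `p ∤ N`, `ρ̄` irreducible: Mazur's Manin
constant, Greenberg–Vatsal/Vatsal canonical periods, Agashe–Ribet–Stein): the ratio
`ϖ = Ω⁺_f / Ω_W` of the `f`-period to the Néron period is a `p`-adic unit. -/
def PeriodUnit (W : WeierstrassCurve ℚ) [W.IsElliptic] [W.IsGloballyMinimal]
    (p : ℕ) [Fact p.Prime] : Prop :=
  ∀ [NeZero (W.conductorNorm ℤ)] (f : CuspForm (Gamma0 (W.conductorNorm ℤ)) 2),
    IsNewformOf W f → ∀ ϖ : ℚ, (ϖ : ℝ) * W.realPeriodRat = plusPeriod f → padicValRat p ϖ = 0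

/-- **μ-upgrade** (support, pure `Λ`-algebra, M-sized): a `Λ[1/p]`-divisibility by `ϖ·L` with
`μ(L) = 0` and `ϖ` a `p`-unit is a `Λ`-divisibility (`p` is prime in `ℤ_p⟦T⟧`,
`dvd_of_dvd_prime_pow_mul`, injectivity of `Λ ↪ ℚ_p⟦T⟧`). -/
def MuUpgrade (p : ℕ) [Fact p.Prime] : Prop :=
  ∀ (ϖ : ℚ) (L g h : IwasawaAlgebra p) (m : ℕ), padicValRat p ϖ = 0 → MuZero L →
    iwasawaToPowerSeries p (PowerSeries.C ((p : ℤ_[p]) ^ m) * g) =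
      PowerSeries.C (ϖ : ℚ_[p]) * iwasawaToPowerSeries p (L * h) →
    ∃ h' : IwasawaAlgebra p,
      iwasawaToPowerSeries p g = PowerSeries.C (ϖ : ℚ_[p]) * iwasawaToPowerSeries p (L * h')

/-- **Uniform horocycle generation (Conn)** — the conjecture; per level a finite coset enumeration. -/
def HorocycleGenerationAll : Prop :=
  ∀ N p : ℕ, p.Prime → ¬ p ∣ N → HorocycleGeneration N p

/-- **Reduction at `p = 3`** (Claim A: chain through `H_P`-translates of `ℙ¹(ℤ[1/p])`, the
homomorphism `γ ↦ φ̄({∞ → γ∞})`, (Conn) ⇒ it is `χ∘(d mod N)`, `T_ℓ`-eigenvalue `1+ℓ` ⇒ Eisenstein ⇒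
contradiction with irreducibility of `ρ̄` (automatic at supersingular `p`); `Δ = {±1}` at `p = 3`
makes the ω⁰-projection lossless). -/
def ReductionAtThree : Prop :=
  ∀ (W : WeierstrassCurve ℚ) [W.IsElliptic] [W.IsGloballyMinimal] (p : ℕ) [Fact p.Prime]
    [NeZero (W.conductorNorm ℤ)] (f : CuspForm (Gamma0 (W.conductorNorm ℤ)) 2),
    p = 3 → IsNewformOf W f → ClassX7 W p → W.frobeniusTrace p = 0 → Surj W p →
    (¬ p ∣ W.conductorNorm ℤ → HorocycleGeneration (W.conductorNorm ℤ) p) →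
    HoroNonvanishing f p

/-- **Descent + stabilisation** (`a_p = 0` three-term relation, `cor` injective mod `p`, upward
induction in steps of two; Kurihara/Perrin-Riou/Pollack–Weston Thm 4.1 and Pollack 2003 Prop 6.18:
`μ(θ_n) = μ(L^{∓})` for `n ≫ 0` of fixed parity). -/
def DescentStabilisation : Prop :=
  ∀ (W : WeierstrassCurve ℚ) [W.IsElliptic] [W.IsGloballyMinimal] (p : ℕ) [Fact p.Prime]
    [NeZero (W.conductorNorm ℤ)] (f : CuspForm (Gamma0 (W.conductorNorm ℤ)) 2),
    p ≠ 2 → IsNewformOf W f → W.frobeniusTrace p = 0 → HoroNonvanishing f p → SignedMuFloorW W p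

/-- **Residual `p ≥ 5`** (named residual, 1769/4377 X7 pairs): the ω⁰-isotypic (Δ-averaged)
horocycle generation `(W⁰)`; numerically Ann(W⁰ + boundary) = 0 at (41,5),(92,5),(48,7),(36,5),
(56,5),(11,5),(37,5), but not yet reduced to group theory. -/
def MuFloorResidualGeFive : Prop :=
  ∀ (W : WeierstrassCurve ℚ) [W.IsElliptic] [W.IsGloballyMinimal] (p : ℕ) [Fact p.Prime],
    5 ≤ p → ClassX7 W p → ¬ W.HasCM → W.frobeniusTrace p = 0 → Surj W p → SignedMuFloorW W p

/-- Existence of the newform (modularity, tree-booked elsewhere; here a binder). -/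
def NewformExists : Prop :=
  ∀ (W : WeierstrassCurve ℚ) [W.IsElliptic] [W.IsGloballyMinimal],
    NeZero (W.conductorNorm ℤ) ∧
    ∀ [NeZero (W.conductorNorm ℤ)], ∃ f : CuspForm (Gamma0 (W.conductorNorm ℤ)) 2, IsNewformOf W f

/-- The μ-half assembled: (Conn) + reduction + descent (p = 3) and the p ≥ 5 residual give the
signed μ-floor on all of X7. Kernel-checked, no `sorry`. -/
theorem signedMuFloorW_of_horocycle (hgen : HorocycleGenerationAll) (hred : ReductionAtThree)
    (hdesc : DescentStabilisation) (hres : MuFloorResidualGeFive) (hnew : NewformExists)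
    (W : WeierstrassCurve ℚ) [W.IsElliptic] [W.IsGloballyMinimal] (p : ℕ) [Fact p.Prime]
    (hp : p ≠ 2) (hX7 : ClassX7 W p) (hCM : ¬ W.HasCM) (hap : W.frobeniusTrace p = 0)
    (hS : Surj W p) : SignedMuFloorW W p := by
  have hprime : p.Prime := Fact.out
  rcases Nat.lt_or_ge p 5 with hlt | hge
  · -- p ∈ {2,3,4} and prime, p ≠ 2 ⇒ p = 3
    have hp3 : p = 3 := by
      have h2 := hprime.two_le
      interval_cases p
      · exact absurd rfl hp
      · rfl
      · exact absurd hprime (by decide)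
    obtain ⟨hN, hf⟩ := hnew W
    haveI := hN
    obtain ⟨f, hf⟩ := hf
    refine hdesc W p f hp hf hap (hred W p f hp3 hf hX7 hap hS ?_)
    intro hndvd
    exact hgen _ _ hprime hndvd
  · exact hres W p hge hX7 hCM hap hS

/-- **The composition concluding the crux BY NAME** (`SignedLowerHalves.KobayashiLowerHalfLargeImage`):
λ-part with `p` inverted for both signs (external engine: affinoid-eisenstein S1–S3, or a rational
signed main conjecture on its locus) + the μ-half of this card + period unit + μ-upgrade algebra.
Kernel-checked, no `sorry`; CLASS route — nothing here proves BSD. -/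
theorem KobayashiLowerHalfLargeImage_of_horocycleMuFloor
    (hlam : ∀ (W : WeierstrassCurve ℚ) [W.IsElliptic] [W.IsGloballyMinimal] (p : ℕ) [Fact p.Prime],
      p ≠ 2 → ClassX7 W p → ¬ W.HasCM → W.frobeniusTrace p = 0 → Surj W p →
      ∀ ε : ℤˣ, LambdaLowerDivisibility W p ε)
    (hgen : HorocycleGenerationAll) (hred : ReductionAtThree) (hdesc : DescentStabilisation)
    (hres : MuFloorResidualGeFive) (hnew : NewformExists)
    (hperiod : ∀ (W : WeierstrassCurve ℚ) [W.IsElliptic] [W.IsGloballyMinimal] (p : ℕ) [Fact p.Prime],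
      p ≠ 2 → ClassX7 W p → Surj W p → PeriodUnit W p)
    (halg : ∀ (p : ℕ) [Fact p.Prime], MuUpgrade p) :
    Summit.BirchSwinnertonDyer.BirchSwinnertonDyer.Theses.SignedLowerHalves.KobayashiLowerHalfLargeImage := by
  intro W _ _ p _ hp hX7 hCM hap hS
  obtain ⟨ε, hε⟩ := signedMuFloorW_of_horocycle hgen hred hdesc hres hnew W p hp hX7 hCM hap hS
  refine ⟨ε, ?_⟩
  intro κ γ hκ hγ hγ' _ f hf ϖ hϖ Lplus Lminus hL D
  obtain ⟨g, h, m, hg, hι⟩ :=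
    hlam W p hp hX7 hCM hap hS ε κ γ hκ hγ hγ' f hf ϖ hϖ Lplus Lminus hL D
  have hmu : MuZero (kobayashiL ε Lplus Lminus) := hε f hf Lplus Lminus hL
  have hunit : padicValRat p ϖ = 0 := hperiod W p hp hX7 hS f hf ϖ hϖ
  obtain ⟨h', hh'⟩ := halg p ϖ (kobayashiL ε Lplus Lminus) g h m hunit hmu hι
  exact ⟨g, h', hg, hh'⟩

/-! ### The algebra behind the Third lemma, proved: `μ = 0` upgrades `Λ[1/p]`-divisibility to
`Λ`-divisibility. -/

/-- In a domain, if `q` is prime, `q ∤ f` and `f ∣ q^m · g`, then `f ∣ g`. -/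
theorem dvd_of_dvd_prime_pow_mul {R : Type*} [CommRing R] [IsDomain R] {q f g : R}
    (hq : Prime q) (hf : ¬ q ∣ f) : ∀ m : ℕ, f ∣ q ^ m * g → f ∣ g := by
  intro m
  induction m generalizing g with
  | zero => intro h; simpa using h
  | succ m ih =>
    intro h
    obtain ⟨u, hu⟩ := h
    -- `q ∣ f * u` and `q ∤ f` ⇒ `q ∣ u`
    have hqu : q ∣ f * u := ⟨q ^ m * g, by rw [← hu]; ring⟩
    rcases hq.dvd_or_dvd hqu with hqf | ⟨v, hv⟩
    · exact absurd hqf hf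
    · apply ih
      refine ⟨v, ?_⟩
      have hq0 : q ≠ 0 := hq.ne_zero
      have : q * (q ^ m * g) = q * (f * v) := by
        calc q * (q ^ m * g) = q ^ (m + 1) * g := by ring
          _ = f * u := hu
          _ = q * (f * v) := by rw [hv]; ring
      exact mul_left_cancel₀ hq0 this

end Summit.BirchSwinnertonDyer.BirchSwinnertonDyer.Cruxes.KobayashiLowerHalfLargeImage.HorocycleMuFloor
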